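import Mathlib.Topology.Algebra.Group.Basic
import Mathlib.Topology.Algebra.OpenSubgroup

/-!
# Extensions of tempered groups, V: the glued topology does not depend on the choice of the cofinal
# tower ([SemiAnbd] Prop 5.2 (iv) p. 64 — `Π^temp_𝔊` is canonical)

Mochizuki, *Semi-graphs of anabelioids*, Publ. RIMS **42** (2006) 221–322, Prop 5.2 (iii)/(iv) p. 64: the
arithmetic tempered group `Π^temp_𝔊 := π₁^temp(B^temp(𝔊))` and its topology are CANONICAL
[cite: MochizukiSemiAnbd2006, Prop 5.2 (iv), p. 64].  In the cell's model (`TemperedExtensionTempered`,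
`ArithTemperedGroupTopology`) the topology on `E = π₁^temp(𝒢) ⋊^out Π_A` is glued from a CHOSEN
kernel sequence `K n` (the level kernels of a chosen cofinal tower of arithmetic levels) — audit INFO
abc-iut-w4-d082 on p417274: "no canonicity claimed".  This PROOF-ONLY file (row T54-B-top; seat
abc-iut-L3-d2) supplies the canonicity:

* `nhds_one_eq_of_mutually_dominated` / `topology_eq_of_mutually_dominated` — two group topologies
  on `E` whose neighbourhoods of `1` have bases `{K n ⊓ aug⁻¹U}` and `{K' m ⊓ aug⁻¹U}` COINCIDE as soon
  as the two kernel families dominate each other (`∀ n, ∃ m, K' m ≤ K n` and conversely) — which is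
  the case for the level kernels of any two cofinal towers, by monotonicity of the level kernel in the
  level (abc-iut-L3-d4 `levelKer_mono`) and cofinality of both towers in `𝓝 1` of `π₁^temp(𝒢)`;
* `isOpen_iff_of_mutually_dominated` — same, phrased on open sets without naming the topologies equal.

Pure topological group theory, no definitions.  Nothing here refers to the IUT corpus; no side is taken
on any disputed claim.
-/

namespace Literature.AnabelianGeometry.SemiGraphs

namespace TemperedExtension

open Topology Filter

universe v w

variable {E : Type w} [Group E] {A : Type v} [Group A] [TopologicalSpace A]
  (aug : E →* A) {ι₁ ι₂ : Type*} (K : ι₁ → Subgroup E) (K' : ι₂ → Subgroup E)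

/-- **Mutually dominating kernel families generate the same neighbourhood filter of `1`.**  If under
`τ` the filter `𝓝 1` has basis `{K n ⊓ aug⁻¹U}` and under `τ'` basis `{K' m ⊓ aug⁻¹U}` (`U` over the open
normal subgroups of `Π_A`), and every `K n` contains some `K' m` and conversely, then the two
neighbourhood filters of `1` are equal. [cite: MochizukiSemiAnbd2006, Prop 5.2 (iv), p. 64] -/
theorem nhds_one_eq_of_mutually_dominated {τ τ' : TopologicalSpace E}
    (hb : (@nhds E τ 1).HasBasis (fun _ : ι₁ × OpenNormalSubgroup A => True)
      (fun nU => ((K nU.1 ⊓ nU.2.toSubgroup.comap aug : Subgroup E) : Set E)))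
    (hb' : (@nhds E τ' 1).HasBasis (fun _ : ι₂ × OpenNormalSubgroup A => True)
      (fun mU => ((K' mU.1 ⊓ mU.2.toSubgroup.comap aug : Subgroup E) : Set E)))
    (hdom : ∀ n, ∃ m, K' m ≤ K n) (hdom' : ∀ m, ∃ n, K n ≤ K' m) :
    @nhds E τ 1 = @nhds E τ' 1 := by
  refine hb.ext hb' (fun nU _ => ?_) (fun mU _ => ?_)
  · obtain ⟨m, hm⟩ := hdom nU.1
    exact ⟨(m, nU.2), trivial, fun x hx => ⟨hm hx.1, hx.2⟩⟩
  · obtain ⟨n, hn⟩ := hdom' mU.1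
    exact ⟨(n, mU.2), trivial, fun x hx => ⟨hn hx.1, hx.2⟩⟩

/-- **Canonicity of the glued tempered topology**: two GROUP topologies on `E` glued from mutually
dominating kernel families (e.g. the level kernels of two cofinal towers of arithmetic levels) are
EQUAL. [cite: MochizukiSemiAnbd2006, Prop 5.2 (iv), p. 64] -/
theorem topology_eq_of_mutually_dominated {τ τ' : TopologicalSpace E}
    (hτ : @IsTopologicalGroup E τ _) (hτ' : @IsTopologicalGroup E τ' _)
    (hb : (@nhds E τ 1).HasBasis (fun _ : ι₁ × OpenNormalSubgroup A => True)
      (fun nU => ((K nU.1 ⊓ nU.2.toSubgroup.comap aug : Subgroup E) : Set E)))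
    (hb' : (@nhds E τ' 1).HasBasis (fun _ : ι₂ × OpenNormalSubgroup A => True)
      (fun mU => ((K' mU.1 ⊓ mU.2.toSubgroup.comap aug : Subgroup E) : Set E)))
    (hdom : ∀ n, ∃ m, K' m ≤ K n) (hdom' : ∀ m, ∃ n, K n ≤ K' m) : τ = τ' :=
  IsTopologicalGroup.ext hτ hτ' (nhds_one_eq_of_mutually_dominated aug K K' hb hb' hdom hdom')

/-- The same with a general basis on one side: a group topology with basis `{K n ⊓ aug⁻¹U}` at `1`
equals any group topology whose neighbourhood filter of `1` has a basis of subgroups `M j` that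
dominate and are dominated by the `K n ⊓ aug⁻¹U` (e.g. the stabilisers of ALL arithmetic tempered
coverings versus those of a cofinal tower). [cite: MochizukiSemiAnbd2006, Prop 5.2 (iv), p. 64] -/
theorem topology_eq_of_dominated_basis {τ τ' : TopologicalSpace E} {ι₃ : Type*} {p : ι₃ → Prop}
    (M : ι₃ → Subgroup E)
    (hτ : @IsTopologicalGroup E τ _) (hτ' : @IsTopologicalGroup E τ' _)
    (hb : (@nhds E τ 1).HasBasis (fun _ : ι₁ × OpenNormalSubgroup A => True)
      (fun nU => ((K nU.1 ⊓ nU.2.toSubgroup.comap aug : Subgroup E) : Set E)))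
    (hb' : (@nhds E τ' 1).HasBasis p (fun j => (M j : Set E)))
    (hdom : ∀ (n : ι₁) (U : OpenNormalSubgroup A), ∃ j, p j ∧ M j ≤ K n ⊓ U.toSubgroup.comap aug)
    (hdom' : ∀ j, p j → ∃ (n : ι₁) (U : OpenNormalSubgroup A), K n ⊓ U.toSubgroup.comap aug ≤ M j) :
    τ = τ' := by
  refine IsTopologicalGroup.ext hτ hτ' (hb.ext hb' (fun nU _ => ?_) (fun j hj => ?_))
  · obtain ⟨j, hj, hle⟩ := hdom nU.1 nU.2
    exact ⟨j, hj, fun x hx => hle hx⟩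
  · obtain ⟨n, U, hle⟩ := hdom' j hj
    exact ⟨(n, U), trivial, fun x hx => hle hx⟩

end TemperedExtension

end Literature.AnabelianGeometry.SemiGraphs
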